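import Summits.ValiantsHypothesis.ValiantsHypothesis.Theorems.LacunarySymmetroidMatrixDescartesDoorA26WallBubblingClassMoments

/-!
# Wall bubbling for `DoorA26` — (W) chain piece: LEVEL SELECTION, MULTI-CLASS (common subsequence, non-degenerate coordinate, class tails)

HONEST FRAMING.  Chain lemma for obligation (W) `stub_weylFaces` of `Cruxes/DoorA26/Lines/wall_bubbling.lean` (stmt-ValiantsHypothesis-19979
`DoorA26`; OPEN, typed, never asserted), re-pointed seat val-sym-door-p1 g13 (W2 #11).  The multi-class assembly of W2 #10: index ALL normalised
moments of a cluster (every value class, every order below the class size) by one finite type `D`; with the cluster scale `μ_ν := ` the maximum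
modulus (so `|M_d^ν| ≤ μ_ν` for all `d` and `= μ_ν` for some `d`), ONE compactness extraction gives a COMMON subsequence along which every normalised
moment converges, and a coordinate attained infinitely often has a limit of modulus `1` (`levelSelection_multi`).  The class tails die along ANY
subsequence from domination + Vandermonde control (`classTail_tendsto_zero`, the tail half of `levelSelection_class` without its extraction).
Together with W2 #8 `classTower_limit` (per class, along the common subsequence) this is the successor's assembly item (i) in kernel form; items
(ii) per-configuration Vandermonde constants, (iii) slot bookkeeping across clusters + the named anatomy stub `stub_weylFaces_generic_nondegLimit`,
(iv) wiring to W2 #7 remain.  No new definitions; nothing here bears on `DoorA26`, `MatrixDescartes` (stmt-ValiantsHypothesis-18050) or `VP ≠ VNP`.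

[folklore] Bolzano–Weierstrass; pigeonhole.
-/

-- `Summit.ValiantsHypothesis.ValiantsHypothesis.…` repeats a component by the D-0017 layout
-- (single-conjunct summit), which the `dupNamespace` linter flags; the name is mandated.
set_option linter.dupNamespace false

namespace Summit.ValiantsHypothesis.ValiantsHypothesis.Theorems.LacunarySymmetroidMatrixDescartes.WallBubbling

open Finset Filter Topology
open scoped BigOperators

/-- **LEVEL SELECTION, MULTI-CLASS.**  Moments `M ν d` (`d ∈ D` finite) dominated by the scale `μ ν > 0` and attaining it at some coordinate for
every `ν` ⇒ a common subsequence with convergent normalised moments, all of modulus `≤ 1`, one of modulus `= 1`. [folklore] -/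
theorem levelSelection_multi {D : Type*} [Fintype D] (M : ℕ → D → ℝ) (μ : ℕ → ℝ) (hμ : ∀ ν, 0 < μ ν)
    (hdom : ∀ ν d, |M ν d| ≤ μ ν) (hatt : ∀ ν, ∃ d, |M ν d| = μ ν) :
    ∃ φ : ℕ → ℕ, StrictMono φ ∧ ∃ c : D → ℝ,
      (∀ d, Tendsto (fun k => M (φ k) d / μ (φ k)) atTop (𝓝 (c d))) ∧ (∀ d, |c d| ≤ 1) ∧ ∃ d, |c d| = 1 := by
  classical
  -- pigeonhole: one coordinate attains the scale infinitely often
  choose dν hdν using hatt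
  have hinf : ∃ d, Set.Infinite {ν | dν ν = d} := by
    by_contra h
    push Not at h
    have hfin : Set.Finite (Set.univ : Set ℕ) := by
      have : (Set.univ : Set ℕ) ⊆ ⋃ d ∈ (Finset.univ : Finset D), {ν | dν ν = d} := by
        intro ν _; simp
      exact Set.Finite.subset (Set.Finite.biUnion (Finset.finite_toSet _) fun d _ => h d) this
    exact Set.infinite_univ hfin
  obtain ⟨d₀, hd₀⟩ := hinf
  -- first extraction: along `ψ`, the coordinate `d₀` attains the scale
  set ψ : ℕ → ℕ := Nat.nth (fun ν => dν ν = d₀) with hψ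
  have hψmono : StrictMono ψ := Nat.nth_strictMono hd₀
  have hψatt : ∀ k, |M (ψ k) d₀| = μ (ψ k) := by
    intro k
    have h1 : dν (ψ k) = d₀ := Nat.nth_mem_of_infinite hd₀ k
    rw [← h1]; exact hdν (ψ k)
  -- second extraction: compactness in `[-1,1]^D`
  set v : ℕ → D → ℝ := fun k d => M (ψ k) d / μ (ψ k) with hv
  have hvmem : ∀ k, v k ∈ Set.Icc (fun _ : D => (-1 : ℝ)) (fun _ => 1) := by
    intro k
    have hab : ∀ d, |v k d| ≤ 1 := by
      intro d
      simp only [hv]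
      rw [abs_div, abs_of_pos (hμ _), div_le_one (hμ _)]
      exact hdom _ d
    exact ⟨fun d => (abs_le.mp (hab d)).1, fun d => (abs_le.mp (hab d)).2⟩
  obtain ⟨c, -, θ, hθ, hlim⟩ := (isCompact_Icc (a := fun _ : D => (-1 : ℝ)) (b := fun _ => 1)).tendsto_subseq hvmem
  have hlim_d : ∀ d, Tendsto (fun k => v (θ k) d) atTop (𝓝 (c d)) := fun d => tendsto_pi_nhds.mp hlim d
  refine ⟨ψ ∘ θ, hψmono.comp hθ, c, ?_, ?_, ⟨d₀, ?_⟩⟩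
  · intro d
    exact (hlim_d d).congr fun k => by simp [hv]
  · intro d
    have h1 : ∀ k, |v (θ k) d| ≤ 1 := fun k => abs_le.mpr ⟨(hvmem (θ k)).1 d, (hvmem (θ k)).2 d⟩
    exact le_of_tendsto ((continuous_abs.tendsto _).comp (hlim_d d)) (Eventually.of_forall h1)
  · have h1 : ∀ k, |v (θ k) d₀| = 1 := by
      intro k
      simp only [hv]
      rw [abs_div, abs_of_pos (hμ _), hψatt, div_self (hμ _).ne']
    have h2 : Tendsto (fun k => |v (θ k) d₀|) atTop (𝓝 |c d₀|) := (continuous_abs.tendsto _).comp (hlim_d d₀)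
    simp only [h1] at h2
    exact (tendsto_nhds_unique tendsto_const_nhds h2).symm ▸ rfl

/-- **Class tails along any subsequence.**  Domination of the class moments by the scale + Vandermonde control ⇒ `(Σ_i |a_i|)·w^n/μ → 0` along
every subsequence `φ` (the tail half of `levelSelection_class`, extraction-free). [folklore] -/
theorem classTail_tendsto_zero {ι : Type*} [Fintype ι] (n : ℕ) (a ε : ℕ → ι → ℝ) (w μ : ℕ → ℝ) (K : ℝ)
    (hμ : ∀ ν, 0 < μ ν) (hw0 : ∀ ν, 0 < w ν) (hwlim : Tendsto w atTop (𝓝 0))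
    (hdom : ∀ ν, ∀ m < n, |∑ i, a ν i * ε ν i ^ m| ≤ μ ν)
    (hV : ∀ ν i, |a ν i| * w ν ^ (n - 1) ≤ K * ∑ m ∈ Finset.range n, |∑ i', a ν i' * ε ν i' ^ m|)
    (φ : ℕ → ℕ) (hφ : StrictMono φ) :
    Tendsto (fun k => (∑ i, |a (φ k) i|) * w (φ k) ^ n / μ (φ k)) atTop (𝓝 0) := by
  -- run `levelSelection_class` on the φ-subsequence data and read off its tail clause along the identity… simpler: repeat the estimate
  have hφt : Tendsto φ atTop atTop := hφ.tendsto_atTop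
  have hbound : ∀ k, |(∑ i, |a (φ k) i|) * w (φ k) ^ n / μ (φ k)| ≤ (Fintype.card ι : ℝ) * (|K| * n) * w (φ k) := by
    intro k
    set ν := φ k
    have hμν := hμ ν
    have hwν := hw0 ν
    rcases Nat.eq_zero_or_pos n with hn | hn
    · subst hn
      have ha : ∀ i, a ν i = 0 := by
        intro i
        have h := hV ν i
        simp only [Nat.zero_sub, pow_zero, mul_one, Finset.range_zero, Finset.sum_empty, mul_zero] at h
        exact abs_eq_zero.mp (le_antisymm h (abs_nonneg _))
      simp [ha]
    · have hsum : (∑ i, |a ν i|) * w ν ^ n ≤ (Fintype.card ι : ℝ) * (|K| * n) * w ν * μ ν := by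
        have hi : ∀ i, |a ν i| * w ν ^ n ≤ (|K| * n) * w ν * μ ν := by
          intro i
          have h1 : |a ν i| * w ν ^ (n - 1) ≤ K * ∑ m ∈ Finset.range n, |∑ i', a ν i' * ε ν i' ^ m| := hV ν i
          have h2 : ∑ m ∈ Finset.range n, |∑ i', a ν i' * ε ν i' ^ m| ≤ n * μ ν := by
            calc ∑ m ∈ Finset.range n, |∑ i', a ν i' * ε ν i' ^ m| ≤ ∑ m ∈ Finset.range n, μ ν :=
                  Finset.sum_le_sum fun m hm => hdom ν m (Finset.mem_range.mp hm)
              _ = n * μ ν := by simp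
          have hS0 : 0 ≤ ∑ m ∈ Finset.range n, |∑ i', a ν i' * ε ν i' ^ m| := Finset.sum_nonneg fun _ _ => abs_nonneg _
          have h3 : K * ∑ m ∈ Finset.range n, |∑ i', a ν i' * ε ν i' ^ m| ≤ |K| * (n * μ ν) :=
            le_trans (mul_le_mul_of_nonneg_right (le_abs_self K) hS0) (mul_le_mul_of_nonneg_left h2 (abs_nonneg K))
          have hpow : w ν ^ n = w ν ^ (n - 1) * w ν := by
            rw [← pow_succ, Nat.sub_add_cancel hn]
          calc |a ν i| * w ν ^ n = (|a ν i| * w ν ^ (n - 1)) * w ν := by rw [hpow, mul_assoc]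
            _ ≤ (|K| * (n * μ ν)) * w ν := mul_le_mul_of_nonneg_right (h1.trans h3) hwν.le
            _ = (|K| * n) * w ν * μ ν := by ring
        calc (∑ i, |a ν i|) * w ν ^ n = ∑ i, |a ν i| * w ν ^ n := by rw [Finset.sum_mul]
          _ ≤ ∑ _i : ι, (|K| * n) * w ν * μ ν := Finset.sum_le_sum fun i _ => hi i
          _ = (Fintype.card ι : ℝ) * (|K| * n) * w ν * μ ν := by
              rw [Finset.sum_const, Finset.card_univ, nsmul_eq_mul]; ring
      rw [abs_div, abs_of_pos hμν, div_le_iff₀ hμν,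
        abs_of_nonneg (mul_nonneg (Finset.sum_nonneg fun _ _ => abs_nonneg _) (pow_nonneg hwν.le _))]
      exact hsum
  have hlim0 : Tendsto (fun k => (Fintype.card ι : ℝ) * (|K| * n) * w (φ k)) atTop (𝓝 0) := by
    simpa using (hwlim.comp hφt).const_mul ((Fintype.card ι : ℝ) * (|K| * n))
  exact squeeze_zero_norm' (Eventually.of_forall hbound) hlim0

end Summit.ValiantsHypothesis.ValiantsHypothesis.Theorems.LacunarySymmetroidMatrixDescartes.WallBubbling
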